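import Summits.AtomisticToContinuum.Crystallization.Theorems.ChargedEnergyGapBallLedger
import Summits.AtomisticToContinuum.Crystallization.Theorems.ChargedEnergyGapGuardedChain
import HarnessLib

/-!
# `ChargedEnergyGap` — the NEIGHBOURHOOD LEDGER: the localised pieces re-typed under the guard with perpetrator-indexed debits
# (cell `decomp-a2c`, lens 3, generation 49, node «NeighbourhoodLedger», part L-C; over parts I-B and L-B)

Part I-B's ledger `excess Q = Σ_x ballExcess x + farExcess` (exact) and glue `BALL ∧ FAR ⟹ NGP` stand, but its two leaves BALL
(`CoreBallPricingOn`) and FAR (`FarFloor`) are REFUTED AS TYPED by the rim flower (generation 48 memo §1): a debit weighted AT THE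
DEBITED SITE is blind to crowders sitting where the account's weight vanishes while their victim sits where it is positive.  Two
repairs, both typed here, kill the flower:
(a) THE GUARD (parts K-A/L-A, free): no rattlers, points pairwise `≥ s = 3/5` — unboundedly many crowders are gone, every `ρ₀`-ball
    holds `≤ (2ρ₀/s + 1)³` points (`card_nearPoints_le`);
(b) NEIGHBOURHOOD DEBITS, indexed by the PERPETRATOR: `ballNearDebit x = Σ_{z other-gross} Σ_{q ∈ Q.points, dist q z ≤ ρ₀} ψ_x(q)`,
    `farNearDebit = Σ_z Σ_q w(q)` — every point of the configuration within `ρ₀` of an other-gross motif site is debited WITH ITS OWN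
    WEIGHT in every account (larger `ρ₀` only weakens the pieces; the glue holds for every `ρ₀ ≥ 0`).  ★ IMMUNITY (`ballWeight_le_ballNearDebit`,
    `farWeight_le_farNearDebit`): a motif site within `ρ₀` of ANY lattice translate of an other-gross site is covered by the debit with
    its full weight (the weights are `Λ`-periodic, §1).  ★ PACKING (`sum_ballNearDebit_add_farNearDebit_le`): by the partition of
    unity the debits of all accounts add up to `Σ_z #(Q.points ∩ B̄(z, ρ₀)) ≤ (2ρ₀/s+1)³ · #other` under the guard — so the glue
    still closes against `NGP_G`'s per-site debit, with `C = (C₀ + C₁)(2ρ₀/s + 1)³`.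

§1 `Λ`-periodicity of the weights (`orbitDist_add_period` … `ballWeight_add_period`).
§2 `nearPoints`, the two neighbourhood debits, immunity, the packing identity and bound.
§3 THE RE-TYPED PIECES `CoreBallPricingG θ ε R r η L δ L' ϱ c₁ s ρ₀ σ` (BALL_G|σ) and `FarFloorG θ ε R r η L δ L' ϱ c₁ s ρ₀`
   (FAR_G), their dials (slack, sub-species, ∀-split `BALL_G ⟺ BALL_G|σ ∧ BALL_G|¬σ`), WEAKER-than-the-refuted-namesakes certificates
   (`coreBallPricingG_of_coreBallPricingOn`, `farFloorG_of_farFloor`: the old pieces imply the new — the converse fails, which is the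
   point), ★★ THE GLUE `incoherentGrossDebitPricingG_of_ballG_farG : BALL_G → FAR_G → NGP_G` (`0 < s`, `0 ≤ ρ₀`), typed end `δ ≥ 5/8`.
§4 ★★ RECORD CONE BY NAME `chargedEnergyGap_of_neighbourhoodLedger_record`, seven leaves:
   `ChargeRecount · IP_G · FCP_G · CCP_G · BALL_G · FAR_G · P_G ⟹ ChargedEnergyGap` at
   `(θ, ε, R, r, η, L, δ, L', ϱ, c₁, s, ρ₀) = (3/20, 1/10, 6/5, 10, 1/100, 40, 1/10, 40, 160, 1/20, 3/5, 10)` (packing constant `(103/3)³`;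
   at `ρ₀ = 10` an undebited gross over-binder gives its victim `≤ Σ_{d>10} d⁻⁶/6 < 7·10⁻³` under `3/5`-separation — memo g49 §3).

TAGS.  BALL_G · UNDECIDED · INSTRUMENTABLE (census L3-BALL under the guard) · IDEA-NEEDED as BALL (rigidity + incompatibility +
core floor for monolithic cores; an area law for walled cores, `TetrahedralFrustration`-ringed) · immune to the rim flower, to every
`M`-crowder family (guard) and to bounded over-binding by other-gross neighbours within `ρ₀` (debit) · NOT immune, by design, to
over-binding transmitted through charted / charge-free matter farther than `ρ₀` from every other-gross site («conformal cladding», memo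
g49 §3: the bet is that it is elastic and second-order small, inside the margins of memo g47 F6).  FAR_G · TRUE-leaning · ATTACKABLE-L
(Cauchy–Born pointwise + harmonic localisation, memo g47 F6; the guard bounds every site excess below a priori).  Both WEAKER than
their refuted namesakes, neither implied by the crux (localisations at scale `160`).  All `[this work]` = cell decomp-a2c lens 3.
-/

noncomputable section
open scoped Classical
open Literature.MathematicalPhysics.StatisticalMechanics
open Literature.Geometry.DiscreteGeometry
open Summit.AtomisticToContinuum.Crystallization.Theses.PricedLinkCensus
open Summit.AtomisticToContinuum.Crystallization.Theorems.ChargedEnergyGapNegative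

namespace Summit.AtomisticToContinuum.Crystallization.Theorems.ChargedEnergyGapChartDial

/-! ## §1 The weights are `Λ`-periodic -/

section Periodic

variable {θ ε R r η L δ L' ϱ : ℝ}

/-- The distance to a lattice orbit is invariant under the lattice. -/
theorem orbitDist_add_period (Q : PeriodicConfiguration 3) (x : Q.motif) {g : E3} (hg : g ∈ Q.lattice) (q : E3) :
    orbitDist Q x (q + g) = orbitDist Q x q := by
  unfold orbitDist
  set O : Set E3 := {z : E3 | ∃ g ∈ Q.lattice, z = (x : E3) + g} with hO
  have hOg : (fun z : E3 => z + g) '' O = O := by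
    ext z
    simp only [Set.mem_image, hO, Set.mem_setOf_eq]
    constructor
    · rintro ⟨z', ⟨g₀, hg₀, rfl⟩, rfl⟩
      exact ⟨g₀ + g, Q.lattice.add_mem hg₀ hg, add_assoc _ _ _⟩
    · rintro ⟨g₀, hg₀, rfl⟩
      exact ⟨(x : E3) + (g₀ - g), ⟨g₀ - g, Q.lattice.sub_mem hg₀ hg, rfl⟩, by rw [add_assoc, sub_add_cancel]⟩
  have hI : Isometry (fun z : E3 => z + g) := (IsometryEquiv.addRight g).isometry
  have h : Metric.infDist (q + g) ((fun z : E3 => z + g) '' O) = Metric.infDist q O := Metric.infDist_image hI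
  rw [hOg] at h
  exact h

/-- Bumps are `Λ`-periodic. -/
theorem bump_add_period (ϱ : ℝ) (Q : PeriodicConfiguration 3) (x : Q.motif) {g : E3} (hg : g ∈ Q.lattice) (q : E3) :
    bump ϱ Q x (q + g) = bump ϱ Q x q := by
  unfold bump; rw [orbitDist_add_period Q x hg q]

/-- Core bumps are `Λ`-periodic. -/
theorem coreBump_add_period (Q : PeriodicConfiguration 3) (x : Q.motif) {g : E3} (hg : g ∈ Q.lattice) (q : E3) :
    coreBump θ ε R r η L δ L' ϱ Q x (q + g) = coreBump θ ε R r η L δ L' ϱ Q x q := by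
  unfold coreBump; rw [bump_add_period ϱ Q x hg q]

/-- The cover is `Λ`-periodic. -/
theorem coverSum_add_period (Q : PeriodicConfiguration 3) {g : E3} (hg : g ∈ Q.lattice) (q : E3) :
    coverSum θ ε R r η L δ L' ϱ Q (q + g) = coverSum θ ε R r η L δ L' ϱ Q q := by
  unfold coverSum; exact Finset.sum_congr rfl fun x _ => coreBump_add_period Q x hg q

/-- The far weight is `Λ`-periodic. -/
theorem farWeight_add_period (Q : PeriodicConfiguration 3) {g : E3} (hg : g ∈ Q.lattice) (q : E3) :
    farWeight θ ε R r η L δ L' ϱ Q (q + g) = farWeight θ ε R r η L δ L' ϱ Q q := by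
  unfold farWeight; rw [coverSum_add_period Q hg q]
/-- The ball weights are `Λ`-periodic. -/
theorem ballWeight_add_period (Q : PeriodicConfiguration 3) (x : Q.motif) {g : E3} (hg : g ∈ Q.lattice) (q : E3) :
    ballWeight θ ε R r η L δ L' ϱ Q x (q + g) = ballWeight θ ε R r η L δ L' ϱ Q x q := by
  unfold ballWeight; rw [coreBump_add_period Q x hg q, farWeight_add_period Q hg q, coverSum_add_period Q hg q]

end Periodic

/-! ## §2 Neighbourhoods of the perpetrators, the two debits, immunity and packing -/

section Debits

/-- The points of `Q` within `ρ₀` of `z` (finitely many: a periodic configuration is locally finite). -/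
def nearPoints (ρ₀ : ℝ) (Q : PeriodicConfiguration 3) (z : E3) : Finset E3 :=
  (Q.finite_inter_points (Metric.isBounded_closedBall (x := z) (r := ρ₀))).toFinset

/-- Membership in `nearPoints`. -/
theorem mem_nearPoints {ρ₀ : ℝ} {Q : PeriodicConfiguration 3} {z q : E3} :
    q ∈ nearPoints ρ₀ Q z ↔ q ∈ Q.points ∧ dist q z ≤ ρ₀ := by
  rw [nearPoints, Set.Finite.mem_toFinset, Set.mem_inter_iff, Metric.mem_closedBall, and_comm]

/-- ★ PACKING UNDER THE GUARD: a `ρ₀`-neighbourhood holds at most `(2ρ₀/s + 1)³` points. -/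
theorem card_nearPoints_le {ε s ρ₀ : ℝ} {Q : PeriodicConfiguration 3} (hG : Guard ε s Q) (hs : 0 < s) (hρ : 0 ≤ ρ₀) (z : E3) :
    ((nearPoints ρ₀ Q z).card : ℝ) ≤ (2 * ρ₀ / s + 1) ^ 3 := by
  have h := card_le_of_separated_of_dist_le (nearPoints ρ₀ Q z) z hs hρ (fun c hc => (mem_nearPoints.1 hc).2)
    (fun c hc d hd hcd => hG.le_dist (mem_nearPoints.1 hc).1 (mem_nearPoints.1 hd).1 hcd)
  rwa [finrank_euclideanSpace_fin] at h

variable (θ ε R r η L δ L' ϱ ρ₀ : ℝ)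

/-- The **NEIGHBOURHOOD DEBIT of the ball account of `x`**: every point of `Q` within `ρ₀` of an other-gross motif site, weighted by
`ψ_x` (indexed by the perpetrator, weighted at the victim). -/
def ballNearDebit (Q : PeriodicConfiguration 3) (x : Q.motif) : ℝ :=
  ∑ z : Q.motif, if IsOtherGross θ ε R r η L δ L' Q z then
    ∑ q ∈ nearPoints ρ₀ Q (z : E3), ballWeight θ ε R r η L δ L' ϱ Q x q else 0

/-- The **NEIGHBOURHOOD DEBIT of the far account**: the same with the far weight `w`. -/
def farNearDebit (Q : PeriodicConfiguration 3) : ℝ :=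
  ∑ z : Q.motif, if IsOtherGross θ ε R r η L δ L' Q z then
    ∑ q ∈ nearPoints ρ₀ Q (z : E3), farWeight θ ε R r η L δ L' ϱ Q q else 0

variable {θ ε R r η L δ L' ϱ ρ₀}

/-- The ball neighbourhood debit is non-negative. -/
theorem ballNearDebit_nonneg (Q : PeriodicConfiguration 3) (x : Q.motif) : 0 ≤ ballNearDebit θ ε R r η L δ L' ϱ ρ₀ Q x :=
  Finset.sum_nonneg fun z _ => by
    split_ifs
    exacts [Finset.sum_nonneg fun q _ => ballWeight_nonneg Q x q, le_rfl]

/-- The far neighbourhood debit is non-negative. -/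
theorem farNearDebit_nonneg (Q : PeriodicConfiguration 3) : 0 ≤ farNearDebit θ ε R r η L δ L' ϱ ρ₀ Q :=
  Finset.sum_nonneg fun z _ => by
    split_ifs
    exacts [Finset.sum_nonneg fun q _ => farWeight_nonneg Q q, le_rfl]

/-- ★ **IMMUNITY (ball accounts)**: a motif site `y` within `ρ₀` of ANY lattice translate `z + g` of an other-gross motif site `z` is
debited in the ball account of every `x` with its full weight `ψ_x(y)` — whatever the weights at the perpetrators (this is what the rim
flower of generation 48 evaded). -/
theorem ballWeight_le_ballNearDebit {Q : PeriodicConfiguration 3} (x y : Q.motif) {z : Q.motif}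
    (hz : IsOtherGross θ ε R r η L δ L' Q z) {g : E3} (hg : g ∈ Q.lattice) (hd : dist (y : E3) ((z : E3) + g) ≤ ρ₀) :
    ballWeight θ ε R r η L δ L' ϱ Q x (y : E3) ≤ ballNearDebit θ ε R r η L δ L' ϱ ρ₀ Q x := by
  have hq : (y : E3) - g ∈ nearPoints ρ₀ Q (z : E3) := by
    refine mem_nearPoints.2 ⟨?_, ?_⟩
    · simpa [sub_eq_add_neg] using Q.add_mem_points (Q.mem_points_of_mem_motif y.2) (Q.lattice.neg_mem hg)
    · have h1 : dist ((y : E3) - g) (z : E3) = dist (y : E3) ((z : E3) + g) := by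
        rw [dist_eq_norm, dist_eq_norm]; congr 1; abel
      rwa [h1]
  have hw : ballWeight θ ε R r η L δ L' ϱ Q x (y : E3) = ballWeight θ ε R r η L δ L' ϱ Q x ((y : E3) - g) := by
    rw [← ballWeight_add_period Q x hg ((y : E3) - g), sub_add_cancel]
  calc ballWeight θ ε R r η L δ L' ϱ Q x (y : E3)
      ≤ ∑ q ∈ nearPoints ρ₀ Q (z : E3), ballWeight θ ε R r η L δ L' ϱ Q x q := by
        rw [hw]; exact Finset.single_le_sum (fun q _ => ballWeight_nonneg Q x q) hq
    _ = (if IsOtherGross θ ε R r η L δ L' Q z then ∑ q ∈ nearPoints ρ₀ Q (z : E3), ballWeight θ ε R r η L δ L' ϱ Q x q else 0) := by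
        rw [if_pos hz]
    _ ≤ ballNearDebit θ ε R r η L δ L' ϱ ρ₀ Q x :=
        Finset.single_le_sum (f := fun z : Q.motif => if IsOtherGross θ ε R r η L δ L' Q z then
            ∑ q ∈ nearPoints ρ₀ Q (z : E3), ballWeight θ ε R r η L δ L' ϱ Q x q else 0)
          (fun z _ => by
            split_ifs
            exacts [Finset.sum_nonneg fun q _ => ballWeight_nonneg Q x q, le_rfl])
          (Finset.mem_univ z)

/-- ★ **IMMUNITY (far account)**: the same for the far weight. -/
theorem farWeight_le_farNearDebit {Q : PeriodicConfiguration 3} (y : Q.motif) {z : Q.motif}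
    (hz : IsOtherGross θ ε R r η L δ L' Q z) {g : E3} (hg : g ∈ Q.lattice) (hd : dist (y : E3) ((z : E3) + g) ≤ ρ₀) :
    farWeight θ ε R r η L δ L' ϱ Q (y : E3) ≤ farNearDebit θ ε R r η L δ L' ϱ ρ₀ Q := by
  have hq : (y : E3) - g ∈ nearPoints ρ₀ Q (z : E3) := by
    refine mem_nearPoints.2 ⟨?_, ?_⟩
    · simpa [sub_eq_add_neg] using Q.add_mem_points (Q.mem_points_of_mem_motif y.2) (Q.lattice.neg_mem hg)
    · have h1 : dist ((y : E3) - g) (z : E3) = dist (y : E3) ((z : E3) + g) := by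
        rw [dist_eq_norm, dist_eq_norm]; congr 1; abel
      rwa [h1]
  have hw : farWeight θ ε R r η L δ L' ϱ Q (y : E3) = farWeight θ ε R r η L δ L' ϱ Q ((y : E3) - g) := by
    rw [← farWeight_add_period Q hg ((y : E3) - g), sub_add_cancel]
  calc farWeight θ ε R r η L δ L' ϱ Q (y : E3)
      ≤ ∑ q ∈ nearPoints ρ₀ Q (z : E3), farWeight θ ε R r η L δ L' ϱ Q q := by
        rw [hw]; exact Finset.single_le_sum (fun q _ => farWeight_nonneg Q q) hq
    _ = (if IsOtherGross θ ε R r η L δ L' Q z then ∑ q ∈ nearPoints ρ₀ Q (z : E3), farWeight θ ε R r η L δ L' ϱ Q q else 0) := by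
        rw [if_pos hz]
    _ ≤ farNearDebit θ ε R r η L δ L' ϱ ρ₀ Q :=
        Finset.single_le_sum (f := fun z : Q.motif => if IsOtherGross θ ε R r η L δ L' Q z then
            ∑ q ∈ nearPoints ρ₀ Q (z : E3), farWeight θ ε R r η L δ L' ϱ Q q else 0)
          (fun z _ => by
            split_ifs
            exacts [Finset.sum_nonneg fun q _ => farWeight_nonneg Q q, le_rfl])
          (Finset.mem_univ z)

/-- The old self-weighted debit is covered by the neighbourhood debit (`ρ₀ ≥ 0`: every other-gross site is in its own neighbourhood). -/
theorem ballOtherCount_le_ballNearDebit (hρ : 0 ≤ ρ₀) (Q : PeriodicConfiguration 3) (x : Q.motif) :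
    ballOtherCount θ ε R r η L δ L' ϱ Q x ≤ ballNearDebit θ ε R r η L δ L' ϱ ρ₀ Q x := by
  refine Finset.sum_le_sum fun z _ => ?_
  by_cases hz : IsOtherGross θ ε R r η L δ L' Q z
  · rw [if_pos hz, if_pos hz]
    exact Finset.single_le_sum (fun q _ => ballWeight_nonneg Q x q)
      (mem_nearPoints.2 ⟨Q.mem_points_of_mem_motif z.2, by rw [dist_self]; exact hρ⟩)
  · rw [if_neg hz, if_neg hz]

/-- The old far debit is covered by the neighbourhood debit. -/
theorem farOtherCount_le_farNearDebit (hρ : 0 ≤ ρ₀) (Q : PeriodicConfiguration 3) :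
    farOtherCount θ ε R r η L δ L' ϱ Q ≤ farNearDebit θ ε R r η L δ L' ϱ ρ₀ Q := by
  refine Finset.sum_le_sum fun z _ => ?_
  by_cases hz : IsOtherGross θ ε R r η L δ L' Q z
  · rw [if_pos hz, if_pos hz]
    exact Finset.single_le_sum (fun q _ => farWeight_nonneg Q q)
      (mem_nearPoints.2 ⟨Q.mem_points_of_mem_motif z.2, by rw [dist_self]; exact hρ⟩)
  · rw [if_neg hz, if_neg hz]

/-- ★ **THE PACKING IDENTITY** (partition of unity): all neighbourhood debits together count every (perpetrator, nearby point) pair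
exactly once: `Σ_x ballNearDebit x + farNearDebit = Σ_{z other-gross} #nearPoints z`. -/
theorem sum_ballNearDebit_add_farNearDebit_eq (Q : PeriodicConfiguration 3) :
    (∑ x : Q.motif, ballNearDebit θ ε R r η L δ L' ϱ ρ₀ Q x) + farNearDebit θ ε R r η L δ L' ϱ ρ₀ Q =
      ∑ z : Q.motif, if IsOtherGross θ ε R r η L δ L' Q z then ((nearPoints ρ₀ Q (z : E3)).card : ℝ) else 0 := by
  simp only [ballNearDebit, farNearDebit]
  rw [Finset.sum_comm, ← Finset.sum_add_distrib]
  refine Finset.sum_congr rfl fun z _ => ?_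
  by_cases hz : IsOtherGross θ ε R r η L δ L' Q z
  · simp only [if_pos hz]
    rw [← Finset.sum_comm, ← Finset.sum_add_distrib, Finset.card_eq_sum_ones, Nat.cast_sum, Nat.cast_one]
    exact Finset.sum_congr rfl fun q _ => ballWeight_sum_add_farWeight Q q
  · simp only [if_neg hz, Finset.sum_const_zero, add_zero]

/-- ★ **THE PACKING BOUND UNDER THE GUARD**: `Σ_x ballNearDebit x + farNearDebit ≤ (2ρ₀/s + 1)³ · #other`. -/
theorem sum_ballNearDebit_add_farNearDebit_le {s : ℝ} {Q : PeriodicConfiguration 3} (hG : Guard ε s Q) (hs : 0 < s) (hρ : 0 ≤ ρ₀) :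
    (∑ x : Q.motif, ballNearDebit θ ε R r η L δ L' ϱ ρ₀ Q x) + farNearDebit θ ε R r η L δ L' ϱ ρ₀ Q ≤
      (2 * ρ₀ / s + 1) ^ 3 * (Nat.card {x : Q.motif // IsOtherGross θ ε R r η L δ L' Q x} : ℝ) := by
  rw [sum_ballNearDebit_add_farNearDebit_eq, ← sum_ite_isOtherGross_eq θ ε R r η L δ L' Q, Finset.mul_sum]
  refine Finset.sum_le_sum fun z _ => ?_
  by_cases hz : IsOtherGross θ ε R r η L δ L' Q z
  · rw [if_pos hz, if_pos hz, mul_one]; exact card_nearPoints_le hG hs hρ _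
  · rw [if_neg hz, if_neg hz, mul_zero]

end Debits

/-! ## §3 The re-typed pieces BALL_G, FAR_G; dials; the glue -/

section Pieces

variable (θ ε R r η L δ L' ϱ c₁ s ρ₀ : ℝ)

/-- piece BALL_G at scale `ϱ`, slack `c₁`, guard `(ε, s)`, debit radius `ρ₀`, restricted to a sub-species `σ` of the cores · UNDECIDED ·
INSTRUMENTABLE · IDEA-NEEDED (as BALL) · immune to the rim flower.  **GUARDED CORE BALL PRICING WITH NEIGHBOURHOOD DEBITS**: in every
GUARDED configuration the smooth `ϱ`-ball account of every incoherent core `x` with `σ x` pays some `κ₀ > c₁` per weighted core inside,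
up to `C₀` per weighted point within `ρ₀` of an other gross charged site. -/
def CoreBallPricingG (σ : ∀ Q : PeriodicConfiguration 3, Q.motif → Prop) : Prop :=
  ∃ κ₀ C₀ : ℝ, c₁ < κ₀ ∧ 0 ≤ C₀ ∧ ∀ Q : PeriodicConfiguration 3, Guard ε s Q → ∀ x : Q.motif, IsCore θ ε R r η L δ L' Q x →
    σ Q x → κ₀ * ballCoreCount θ ε R r η L δ L' ϱ Q x - C₀ * ballNearDebit θ ε R r η L δ L' ϱ ρ₀ Q x ≤
      ballExcess θ ε R r η L δ L' ϱ Q x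

/-- piece FAR_G · TRUE-leaning · ATTACKABLE-L (Cauchy–Born pointwise, memo g47 F6) · immune to the rim flower.  **GUARDED FAR FLOOR WITH
NEIGHBOURHOOD DEBITS**: in every GUARDED configuration the far account is at least `−C₁` per weighted point within `ρ₀` of an other
gross charged site, minus `c₁` per incoherent core. -/
def FarFloorG : Prop :=
  ∃ C₁ : ℝ, 0 ≤ C₁ ∧ ∀ Q : PeriodicConfiguration 3, Guard ε s Q →
    -(C₁ * farNearDebit θ ε R r η L δ L' ϱ ρ₀ Q) - c₁ * (motifCoreIncoherent θ ε R r η L δ L' Q : ℝ) ≤ farExcess θ ε R r η L δ L' ϱ Q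

variable {θ ε R r η L δ L' ϱ c₁ s ρ₀}

/-- Restriction is monotone in the sub-species. -/
theorem CoreBallPricingG.mono {σ τ : ∀ Q : PeriodicConfiguration 3, Q.motif → Prop} (hστ : ∀ Q x, τ Q x → σ Q x)
    (h : CoreBallPricingG θ ε R r η L δ L' ϱ c₁ s ρ₀ σ) : CoreBallPricingG θ ε R r η L δ L' ϱ c₁ s ρ₀ τ := by
  obtain ⟨κ₀, C₀, hκ, hC, hball⟩ := h
  exact ⟨κ₀, C₀, hκ, hC, fun Q hQ x hx hτ => hball Q hQ x hx (hστ Q x hτ)⟩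

/-- The slack dial: BALL_G is antitone in the slack … -/
theorem CoreBallPricingG.anti {c₁' : ℝ} (hc : c₁' ≤ c₁) {σ : ∀ Q : PeriodicConfiguration 3, Q.motif → Prop}
    (h : CoreBallPricingG θ ε R r η L δ L' ϱ c₁ s ρ₀ σ) : CoreBallPricingG θ ε R r η L δ L' ϱ c₁' s ρ₀ σ := by
  obtain ⟨κ₀, C₀, hκ, hC, hball⟩ := h
  exact ⟨κ₀, C₀, hc.trans_lt hκ, hC, hball⟩

/-- … and FAR_G is monotone in it. -/
theorem FarFloorG.mono {c₁' : ℝ} (hc : c₁ ≤ c₁') (h : FarFloorG θ ε R r η L δ L' ϱ c₁ s ρ₀) :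
    FarFloorG θ ε R r η L δ L' ϱ c₁' s ρ₀ := by
  obtain ⟨C₁, hC, hfar⟩ := h
  refine ⟨C₁, hC, fun Q hQ => le_trans ?_ (hfar Q hQ)⟩
  have : (0 : ℝ) ≤ (motifCoreIncoherent θ ε R r η L δ L' Q : ℝ) := Nat.cast_nonneg _
  nlinarith

/-- WEAKER than the refuted namesake: the old BALL|σ implies BALL_G|σ (guard dropped, debit enlarged; `ρ₀ ≥ 0`). -/
theorem coreBallPricingG_of_coreBallPricingOn (hρ : 0 ≤ ρ₀) {σ : ∀ Q : PeriodicConfiguration 3, Q.motif → Prop}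
    (h : CoreBallPricingOn θ ε R r η L δ L' ϱ c₁ σ) : CoreBallPricingG θ ε R r η L δ L' ϱ c₁ s ρ₀ σ := by
  obtain ⟨κ₀, C₀, hκ, hC, hball⟩ := h
  refine ⟨κ₀, C₀, hκ, hC, fun Q _ x hx hσ => le_trans ?_ (hball Q x hx hσ)⟩
  nlinarith [ballOtherCount_le_ballNearDebit (θ := θ) (ε := ε) (R := R) (r := r) (η := η) (L := L) (δ := δ) (L' := L') (ϱ := ϱ)
    hρ Q x]

/-- WEAKER than the refuted namesake: the old FAR implies FAR_G (`ρ₀ ≥ 0`). -/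
theorem farFloorG_of_farFloor (hρ : 0 ≤ ρ₀) (h : FarFloor θ ε R r η L δ L' ϱ c₁) : FarFloorG θ ε R r η L δ L' ϱ c₁ s ρ₀ := by
  obtain ⟨C₁, hC, hfar⟩ := h
  refine ⟨C₁, hC, fun Q _ => le_trans ?_ (hfar Q)⟩
  nlinarith [farOtherCount_le_farNearDebit (θ := θ) (ε := ε) (R := R) (r := r) (η := η) (L := L) (δ := δ) (L' := L') (ϱ := ϱ)
    hρ Q]

/-- ★ **EXACT ∀-SPLIT** of BALL_G along any cut `σ` of the cores: `BALL_G|⊤ ⟺ BALL_G|σ ∧ BALL_G|¬σ`. -/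
theorem coreBallPricingG_iff_on_and_on_not (σ : ∀ Q : PeriodicConfiguration 3, Q.motif → Prop) :
    CoreBallPricingG θ ε R r η L δ L' ϱ c₁ s ρ₀ (fun _ _ => True) ↔
      CoreBallPricingG θ ε R r η L δ L' ϱ c₁ s ρ₀ σ ∧ CoreBallPricingG θ ε R r η L δ L' ϱ c₁ s ρ₀ fun Q x => ¬ σ Q x := by
  constructor
  · intro h
    exact ⟨h.mono fun _ _ _ => trivial, h.mono fun _ _ _ => trivial⟩
  · rintro ⟨⟨κ₁, C₁, hκ₁, hC₁, h₁⟩, ⟨κ₂, C₂, hκ₂, hC₂, h₂⟩⟩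
    refine ⟨min κ₁ κ₂, max C₁ C₂, lt_min hκ₁ hκ₂, le_max_of_le_left hC₁, fun Q hQ x hx _ => ?_⟩
    have hcc := ballCoreCount_nonneg (θ := θ) (ε := ε) (R := R) (r := r) (η := η) (L := L) (δ := δ) (L' := L') (ϱ := ϱ) Q x
    have hoc := ballNearDebit_nonneg (θ := θ) (ε := ε) (R := R) (r := r) (η := η) (L := L) (δ := δ) (L' := L') (ϱ := ϱ)
      (ρ₀ := ρ₀) Q x
    by_cases hσ : σ Q x
    · have := h₁ Q hQ x hx hσ
      nlinarith [min_le_left κ₁ κ₂, le_max_left C₁ C₂]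
    · have := h₂ Q hQ x hx hσ
      nlinarith [min_le_right κ₁ κ₂, le_max_right C₁ C₂]

/-- ★★ **THE GLUE** (every parameter, scale, slack, guard `0 < s`, radius `ρ₀ ≥ 0`): `BALL_G ∧ FAR_G ⟹ NGP_G`, with
`κ = κ₀ − c₁ > 0` and `C = (C₀ + C₁)(2ρ₀/s + 1)³`. -/
theorem incoherentGrossDebitPricingG_of_ballG_farG (hs : 0 < s) (hρ : 0 ≤ ρ₀)
    (hB : CoreBallPricingG θ ε R r η L δ L' ϱ c₁ s ρ₀ fun _ _ => True) (hF : FarFloorG θ ε R r η L δ L' ϱ c₁ s ρ₀) :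
    IncoherentGrossDebitPricingG θ ε R r η L δ L' s := by
  obtain ⟨κ₀, C₀, hκ, hC₀, hball⟩ := hB
  obtain ⟨C₁, hC₁, hfar⟩ := hF
  have hP : (0 : ℝ) ≤ (2 * ρ₀ / s + 1) ^ 3 := by positivity
  refine ⟨κ₀ - c₁, (C₀ + C₁) * (2 * ρ₀ / s + 1) ^ 3, sub_pos.2 hκ, by positivity, fun Q hQ => ?_⟩
  have hL := excess_eq_ballExcess_add_farExcess (θ := θ) (ε := ε) (R := R) (r := r) (η := η) (L := L) (δ := δ) (L' := L')
    (ϱ := ϱ) Q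
  have hballs : (∑ x : Q.motif, (κ₀ * ballCoreCount θ ε R r η L δ L' ϱ Q x - C₀ * ballNearDebit θ ε R r η L δ L' ϱ ρ₀ Q x)) ≤
      ∑ x : Q.motif, ballExcess θ ε R r η L δ L' ϱ Q x := by
    refine Finset.sum_le_sum fun x _ => ?_
    by_cases hx : IsCore θ ε R r η L δ L' Q x
    · exact hball Q hQ x hx trivial
    · rw [ballExcess_of_not_isCore hx, ballCoreCount_of_not_isCore hx, mul_zero, zero_sub, neg_nonpos]
      exact mul_nonneg hC₀ (ballNearDebit_nonneg Q x)
  rw [Finset.sum_sub_distrib, ← Finset.mul_sum, ← Finset.mul_sum, sum_ballCoreCount_eq] at hballs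
  have hF' := hfar Q hQ
  have hpack := sum_ballNearDebit_add_farNearDebit_le (θ := θ) (ε := ε) (R := R) (r := r) (η := η) (L := L) (δ := δ) (L' := L')
    (ϱ := ϱ) (ρ₀ := ρ₀) hQ hs hρ
  have hfn := farNearDebit_nonneg (θ := θ) (ε := ε) (R := R) (r := r) (η := η) (L := L) (δ := δ) (L' := L') (ϱ := ϱ) (ρ₀ := ρ₀) Q
  have hbn : 0 ≤ ∑ x : Q.motif, ballNearDebit θ ε R r η L δ L' ϱ ρ₀ Q x :=
    Finset.sum_nonneg fun x _ => ballNearDebit_nonneg Q x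
  rw [cast_motifChargedGross_sub_incoherent θ ε R r η L δ L' Q]
  set O := (Nat.card {x : Q.motif // IsOtherGross θ ε R r η L δ L' Q x} : ℝ)
  have h1 : C₀ * ∑ x : Q.motif, ballNearDebit θ ε R r η L δ L' ϱ ρ₀ Q x ≤ C₀ * ((2 * ρ₀ / s + 1) ^ 3 * O) :=
    mul_le_mul_of_nonneg_left (by linarith) hC₀
  have h2 : C₁ * farNearDebit θ ε R r η L δ L' ϱ ρ₀ Q ≤ C₁ * ((2 * ρ₀ / s + 1) ^ 3 * O) :=
    mul_le_mul_of_nonneg_left (by linarith) hC₁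
  nlinarith [hL, hballs, hF', h1, h2]

/-- Typed end `δ ≥ 5/8` (no incoherent core, part H-A): BALL_G is vacuous … -/
theorem coreBallPricingG_of_five_eighths_le (hδ : 5 / 8 ≤ δ) (σ : ∀ Q : PeriodicConfiguration 3, Q.motif → Prop) :
    CoreBallPricingG θ ε R r η L δ L' ϱ c₁ s ρ₀ σ :=
  ⟨c₁ + 1, 0, lt_add_one c₁, le_rfl, fun Q _ x hx _ =>
    (hx.not_coherentWithin (coherentWithin_of_five_eighths_le hδ L' Q (x : E3))).elim⟩

/-- … and FAR_G is `excess ≥ 0`. -/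
theorem farFloorG_of_five_eighths_le (hδ : 5 / 8 ≤ δ) : FarFloorG θ ε R r η L δ L' ϱ c₁ s ρ₀ := by
  refine ⟨0, le_rfl, fun Q _ => ?_⟩
  have hno : ∀ x : Q.motif, ¬ IsCore θ ε R r η L δ L' Q x := fun x hx =>
    hx.not_coherentWithin (coherentWithin_of_five_eighths_le hδ L' Q _)
  rw [farExcess_eq_excess_of_forall_not_isCore hno, motifCoreIncoherent_eq_zero_of_five_eighths_le hδ, Nat.cast_zero, mul_zero,
    sub_zero, zero_mul, neg_zero]
  exact excess_nonneg' Q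

end Pieces

/-! ## §4 The record `(…, ϱ, c₁, s, ρ₀) = (…, 160, 1/20, 3/5, 10)`: the cone by name -/

section Record

/-- ★ THE GUARDED ENGINE TARGET of record from the two re-typed pieces of record (packing constant `(2·10/(3/5) + 1)³ = (103/3)³`). -/
theorem incoherentGrossDebitPricingG_record_of_ballG_farG
    (hB : CoreBallPricingG (3 / 20) (1 / 10) (6 / 5) 10 (1 / 100) 40 (1 / 10) 40 160 (1 / 20) (3 / 5) 10 fun _ _ => True)
    (hF : FarFloorG (3 / 20) (1 / 10) (6 / 5) 10 (1 / 100) 40 (1 / 10) 40 160 (1 / 20) (3 / 5) 10) :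
    IncoherentGrossDebitPricingG (3 / 20) (1 / 10) (6 / 5) 10 (1 / 100) 40 (1 / 10) 40 (3 / 5) :=
  incoherentGrossDebitPricingG_of_ballG_farG (by norm_num) (by norm_num) hB hF

/-- ★★ **RECORD CONE**, seven named leaves: `ChargedEnergyGap` from `ChargeRecount` · IP_G · FCP_G · CCP_G · BALL_G · FAR_G · P_G, all
under the guard `(ε, s) = (1/10, 3/5)`. -/
theorem chargedEnergyGap_of_neighbourhoodLedger_record (hF : ChargeRecount)
    (hIP : ImprovablePricingG (3 / 20) (1 / 10) (6 / 5) 10 (1 / 100) (3 / 5))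
    (hFCP : FrustratedCorePricingG (3 / 20) (1 / 10) (6 / 5) 10 (1 / 100) 40 (3 / 5))
    (hCCP : CoherentCorePricingG (3 / 20) (1 / 10) (6 / 5) 10 (1 / 100) 40 (1 / 10) 40 (3 / 5))
    (hB : CoreBallPricingG (3 / 20) (1 / 10) (6 / 5) 10 (1 / 100) 40 (1 / 10) 40 160 (1 / 20) (3 / 5) 10 fun _ _ => True)
    (hFar : FarFloorG (3 / 20) (1 / 10) (6 / 5) 10 (1 / 100) 40 (1 / 10) 40 160 (1 / 20) (3 / 5) 10)
    (hP : ChartedChargePricingG (3 / 20) (1 / 10) (3 / 5)) : ChargedEnergyGap :=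
  chargedEnergyGap_of_guardedChain hF le_rfl hIP hFCP hCCP (incoherentGrossDebitPricingG_record_of_ballG_farG hB hFar) hP

end Record

end Summit.AtomisticToContinuum.Crystallization.Theorems.ChargedEnergyGapChartDial
end
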